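import Literature.NumberTheory.EllipticCurves.WeilPairingProofs
import Literature.NumberTheory.EllipticCurves.IsogenyQuotientPlacesProofs
import Literature.NumberTheory.EllipticCurves.LangTorsor
import Literature.NumberTheory.DiophantineGeometry.FunctionFieldDivisorsAdicProofs
import HarnessLib

/-!
# Geometric points of an elliptic curve versus places of its function field over the base field

Topic `NumberTheory/EllipticCurves`. For an elliptic curve `W` over a field `k` with function field
`K = k(W)` and geometric function field `k̄(W)` (`WeierstrassCurve.geomFunctionField`), this file
relates the places of `K/k` (closed points) to the geometric points `E(k̄)`
(`WeierstrassCurve.geomPoints`), on top of the tree's values/places/Galois-action theory of `k̄(W)`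
(`FunctionFieldTranslation`, `IsogenyDegreeKernelProofs`, `WeilPairingDivisors`, `WeilPairingProofs`):

* `toGeom W : k(W) →ₐ[k] k̄(W)` — the embedding `ι` (`x ↦ x`, `y ↦ y`; the tree's `funcAlgHom` at
  the generic point): `toGeom_algebraMap_mk`, `evalBase` (evaluation of `k[W]` at a geometric
  point), `hasValueAt_toGeom_algebraMap` (`ι r` has the value `r(P)`), **`galFunctionField_toGeom`**
  (`Γ_k` fixes `ι k(W)`), `HasValueAt.toGeom_smul`, `ord_smul_toGeom`, `toGeom_mem_place_smul_iff`;
* **`belowPlace W P`** — the place `ι⁻¹(k̄[W]_P)` of `k(W)` below the geometric point `P`: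
  `belowPlace_zero` (= the place at infinity), `belowPlace_smul` (`Γ_k`-conjugates lie over the
  same place), `algebraMap_mem_belowPlace` / `xF_mem_belowPlace` (below an affine point the place is
  finite), `valuation_algebraMap_lt_one_iff` (`r ≡ 0 ↔ r(P) = 0`);
* `kerPrime W h` — the prime `𝔭_P = {r : r(P) = 0}` of `k[W]`, **`belowPlace_some_eq_ofPrime`**
  (the place below `P` is the finite place of `𝔭_P`); `quotEquivResidueField` (`k[W]/𝔭 ≅ κ(𝔭)` for
  every prime), `finrank_quot_eq_degree`; `resEmb` (`k[W]/𝔭_P ↪ k̄`), `evalBase_smul`;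
* over a **finite** field `k` with arithmetic Frobenius `σ` (`σ x = x^q`): the fibre of `belowPlace`
  over the place below an affine `P` is the Frobenius orbit `{σ^j P : j < deg v}` —
  **`pow_degree_smul_eq`** (`σ^{deg v} P = P`), **`pow_smul_injOn`** (the `σ^j P`, `j < deg v`, are
  distinct), **`exists_eq_pow_smul`** (every point over the same place is some `σ^j P`), through the
  `deg v` embeddings `k[W]/𝔭_P → k̄` (Mathlib `AlgHom.card`, `FiniteField.orderOf_frobeniusAlgHom`);
* **`exists_belowPlace_eq`**: every place of `k(W)` lies below some geometric point
  (`exists_kerPrime_eq`: embed `k[W]/𝔭` into `k̄`); `belowPlace_eq_infPlace_iff`.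

This is the "closed points = Galois orbits of geometric points" dictionary (Stichtenoth Thm. 3.6.3 for
the constant field extension `k̄(W)/k(W)`; Silverman *AEC* II.§1–§2, Ex. 2.13), used by the Lang
torsor files to read Frobenius elements and Abel's theorem over `k̄` in terms of places of `k(W)`.
Everything is proved; no named facts; all definitions are genuine.

## References

* J. H. Silverman, *The Arithmetic of Elliptic Curves*, 2nd ed., GTM 106, II.§1–§2 (points and
  places, `G_{K̄/K}` acting on `K̄(C)`), Ex. 2.13. [SilvermanAEC2009]
* H. Stichtenoth, *Algebraic Function Fields and Codes*, 2nd ed., GTM 254, Def. 1.1.13–1.1.15, §3.6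
  (constant field extensions: Thm. 3.6.3). [Stichtenoth2009]
-/

noncomputable section

open scoped Classical Polynomial.Bivariate
open Polynomial WeierstrassCurve WeierstrassCurve.Affine
open Literature.NumberTheory.EllipticCurves.WeierstrassFunctionField
open Literature.NumberTheory.DiophantineGeometry Literature.NumberTheory.DiophantineGeometry.AlgFunctionField

universe u

namespace Literature.NumberTheory.EllipticCurves.WeierstrassGeometricPlaces

variable {F : Type u} [Field F] (W : WeierstrassCurve F)

/-! ### The embedding `ι : k(W) → k̄(W)` -/

section Embedding

/-- `x ∈ k̄(W)` is transcendental over `k` (it is over `k̄`). [folklore] -/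
theorem transcendental_genX_base : Transcendental F W.genX := fun h =>
  W.transcendental_genX (h.tower_top (AlgebraicClosure F))

/-- **The embedding `ι : k(W) → k̄(W)`** of the function field into the geometric function field
(`x ↦ x`, `y ↦ y`): the field-level constant field extension `k(W) ⊗_k k̄`.
[cite: SilvermanAEC2009, II.§1–§2] -/
def toGeom : W.toAffine.FunctionField →ₐ[F] W.geomFunctionField :=
  funcAlgHom (V := W.toAffine) W.genX W.genY
    (LangTorsor.evalEval_map_polynomial_eq_zero (W := W) (W.equation_genX_genY)) (transcendental_genX_base W)

/-- `ι x = x`. [folklore] -/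
theorem toGeom_xF : toGeom W (xF W.toAffine) = W.genX :=
  funcAlgHom_xF _ _ _ _

/-- `ι y = y`. [folklore] -/
theorem toGeom_yF : toGeom W (yF W.toAffine) = W.genY :=
  funcAlgHom_yF _ _ _ _

/-- `ι` is injective. [folklore] -/
theorem toGeom_injective : Function.Injective (toGeom W) := (toGeom W).toRingHom.injective

/-- **`ι` on regular functions**: `ι (p(x, y)) = p̄(x, y)` where `p̄` is `p` with coefficients in `k̄`.
[folklore] -/
theorem toGeom_algebraMap_mk (p : F[X][Y]) :
    toGeom W (algebraMap W.toAffine.CoordinateRing W.toAffine.FunctionField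
      (Affine.CoordinateRing.mk W.toAffine p)) =
      algebraMap W.geomCoordRing W.geomFunctionField
        (Affine.CoordinateRing.mk (W.baseChange (AlgebraicClosure F)).toAffine
          (p.map (mapRingHom (algebraMap F (AlgebraicClosure F))))) := by
  rw [toGeom, funcAlgHom_algebraMap, pointAlgHom_mk, WeierstrassFunctionField.algebraMap_mk,
    aevalAeval_eq_evalEval_map, Polynomial.map_map, mapRingHom_comp, ← IsScalarTower.algebraMap_eq]

/-- **Evaluation of regular functions of `k[W]` at a geometric affine point** `(a, b) ∈ E(k̄)`:
the `k`-algebra map `x ↦ a`, `y ↦ b`. [cite: SilvermanAEC2009, I.§1 and II.§1] -/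
def evalBase {a b : AlgebraicClosure F} (h : (W.baseChange (AlgebraicClosure F)).toAffine.Nonsingular a b) :
    W.toAffine.CoordinateRing →ₐ[F] AlgebraicClosure F :=
  pointAlgHom W.toAffine a b (LangTorsor.evalEval_map_polynomial_eq_zero (W := W) h.left)

/-- `evalBase` on the class of `p(X, Y)` is `p(a, b)`. [folklore] -/
theorem evalBase_mk {a b : AlgebraicClosure F} (h : (W.baseChange (AlgebraicClosure F)).toAffine.Nonsingular a b)
    (p : F[X][Y]) :
    evalBase W h (Affine.CoordinateRing.mk W.toAffine p) =
      (p.map (mapRingHom (algebraMap F (AlgebraicClosure F)))).evalEval a b :=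
  pointAlgHom_mk _ _ _ p

/-- `evalBase` is the geometric evaluation `evalAt` of the base-changed function. [folklore] -/
theorem evalAt_mk_map {a b : AlgebraicClosure F} (h : (W.baseChange (AlgebraicClosure F)).toAffine.Nonsingular a b)
    (p : F[X][Y]) :
    evalAt h (Affine.CoordinateRing.mk (W.baseChange (AlgebraicClosure F)).toAffine
      (p.map (mapRingHom (algebraMap F (AlgebraicClosure F))))) =
      evalBase W h (Affine.CoordinateRing.mk W.toAffine p) := by
  rw [evalAt_mk, evalBase_mk]

/-- **`ι(r)` has the value `r(P)` at the affine geometric point `P = (a, b)`** for `r ∈ k[W]`.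
[cite: SilvermanAEC2009, II.§1] -/
theorem hasValueAt_toGeom_algebraMap {a b : AlgebraicClosure F}
    (h : (W.baseChange (AlgebraicClosure F)).toAffine.Nonsingular a b) (r : W.toAffine.CoordinateRing) :
    W.HasValueAt (toGeom W (algebraMap W.toAffine.CoordinateRing W.toAffine.FunctionField r))
      (.some a b h) (evalBase W h r) := by
  obtain ⟨p, rfl⟩ := AdjoinRoot.mk_surjective r
  change W.HasValueAt (toGeom W (algebraMap _ _ (Affine.CoordinateRing.mk W.toAffine p))) _
    (evalBase W h (Affine.CoordinateRing.mk W.toAffine p))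
  rw [toGeom_algebraMap_mk, ← evalAt_mk_map]
  exact hasValueAt_algebraMap_geomCoordRing h _

/-- **`Γ_k` fixes `ι(k(W))`**: `σ̃ (ι h) = ι h` for `σ ∈ Gal(k̄/k)` acting on `k̄(W)` through the
coefficients (both `k`-algebra maps `k(W) → k̄(W)` send `x ↦ x`, `y ↦ y`).
[cite: SilvermanAEC2009, II.§2] -/
theorem galFunctionField_toGeom (σ : Field.absoluteGaloisGroup F) (z : W.toAffine.FunctionField) :
    W.galFunctionField σ (toGeom W z) = toGeom W z := by
  have key : ((W.galFunctionFieldAlgEquiv σ : W.geomFunctionField →ₐ[F] W.geomFunctionField).comp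
      (toGeom W)) = toGeom W := by
    refine algHom_ext_xy ?_ ?_
    · rw [AlgHom.comp_apply, toGeom_xF]
      exact W.galFunctionField_genX σ
    · rw [AlgHom.comp_apply, toGeom_yF]
      exact W.galFunctionField_genY σ
  exact congrArg (fun f => f z) key

/-- **Values of `ι h` are `Γ_k`-equivariant**: if `(ι h)(P) = c` then `(ι h)(σ P) = σ c`.
[cite: SilvermanAEC2009, II.§2] -/
theorem HasValueAt.toGeom_smul {z : W.toAffine.FunctionField} {P : W.geomPoints} {c : AlgebraicClosure F}
    (hz : W.HasValueAt (toGeom W z) P c) (σ : Field.absoluteGaloisGroup F) :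
    W.HasValueAt (toGeom W z) (σ • P) (σ • c) := by
  have h := hz.galFunctionField σ
  rwa [galFunctionField_toGeom] at h

variable [W.IsElliptic]

/-- **`ord_{σP}(ι h) = ord_P(ι h)`.** [cite: SilvermanAEC2009, II.§2] -/
theorem ord_smul_toGeom (σ : Field.absoluteGaloisGroup F) (P : W.geomPoints) (z : W.toAffine.FunctionField) :
    ord (W.baseChange (AlgebraicClosure F)).toAffine (σ • P) (toGeom W z) =
      ord (W.baseChange (AlgebraicClosure F)).toAffine P (toGeom W z) := by
  conv_lhs => rw [← galFunctionField_toGeom W σ z]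
  exact W.ord_galFunctionField σ P _

/-- `ι h` is regular at `σ P` iff it is regular at `P`. [cite: SilvermanAEC2009, II.§2] -/
theorem toGeom_mem_place_smul_iff (σ : Field.absoluteGaloisGroup F) (P : W.geomPoints)
    (z : W.toAffine.FunctionField) :
    toGeom W z ∈ (W.place (σ • P)).toValuationSubring ↔ toGeom W z ∈ (W.place P).toValuationSubring := by
  rw [mem_place_iff, mem_place_iff]
  conv_lhs => rw [← galFunctionField_toGeom W σ z, W.placeValuation_galFunctionField σ P]

end Embedding

/-! ### The place of `k(W)` below a geometric point -/

section BelowPlace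

variable [W.IsElliptic]

omit [W.IsElliptic] in
/-- A nonzero non-unit of a valuation ring has its inverse outside the ring. [folklore] -/
theorem inv_not_mem_of_mem_nonunits {L : Type*} [Field L] (O : ValuationSubring L) {n : L} (hn0 : n ≠ 0)
    (hn : n ∈ O.nonunits) : n⁻¹ ∉ O := by
  intro hinv
  rw [ValuationSubring.mem_nonunits_iff] at hn
  have h1 : O.valuation n⁻¹ ≤ 1 := (O.valuation_le_one_iff _).2 hinv
  have : O.valuation (n * n⁻¹) < 1 := by
    rw [Valuation.map_mul]
    calc O.valuation n * O.valuation n⁻¹ ≤ O.valuation n * 1 := by gcongr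
      _ < 1 := by rw [mul_one]; exact hn
  rw [mul_inv_cancel₀ hn0, Valuation.map_one] at this
  exact lt_irrefl _ this

/-- For every geometric point `P` some `z ∈ k(W)` is not regular at `P` (at `O`: `x`; at an affine
`P = (a, b)`: `1/μ(x)` for the minimal polynomial `μ` of `a` over `k`). [folklore] -/
theorem exists_toGeom_not_mem_place (P : W.geomPoints) :
    ∃ z : W.toAffine.FunctionField, toGeom W z ∉ (W.place P).toValuationSubring := by
  rcases eq_or_ne P 0 with rfl | hP
  · refine ⟨xF W.toAffine, ?_⟩
    rw [toGeom_xF, place_zero]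
    exact WeierstrassPlaceAtInfinity.x_not_mem_infPlace _
  · obtain ⟨a, b, h, rfl⟩ := geomPoints.exists_eq_some hP
    set μ : F[X] := minpoly F a with hμ
    have hμ0 : μ ≠ 0 := minpoly.ne_zero (Algebra.IsIntegral.isIntegral a)
    set r : W.toAffine.CoordinateRing := algebraMap F[X] W.toAffine.CoordinateRing μ with hr
    set n : W.toAffine.FunctionField := algebraMap W.toAffine.CoordinateRing W.toAffine.FunctionField r
      with hn
    have hval : W.HasValueAt (toGeom W n) (.some a b h) 0 := by
      have hv := hasValueAt_toGeom_algebraMap W h r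
      have h0 : evalBase W h r = 0 := by
        rw [hr, evalBase, pointAlgHom_algebraMap, hμ, minpoly.aeval]
      rwa [h0] at hv
    have hr0 : r ≠ 0 := fun h0 => hμ0
      (Literature.NumberTheory.EllipticCurves.WeierstrassCoordinateRing.algebraMap_injective W.toAffine
        (by rw [← hr, h0, map_zero]))
    have hn0 : n ≠ 0 := fun h0 => hr0 (IsFractionRing.injective W.toAffine.CoordinateRing
      W.toAffine.FunctionField (by rw [← hn, h0, map_zero]))
    have hgn0 : toGeom W n ≠ 0 := (_root_.map_ne_zero _).2 hn0
    refine ⟨n⁻¹, ?_⟩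
    rw [map_inv₀]
    refine inv_not_mem_of_mem_nonunits _ hgn0 ?_
    have := (hval.mem_place (Affine.Point.some_ne_zero _)).2
    rwa [map_zero, sub_zero] at this

/-- `ι⁻¹(k̄[W]_P) ≠ k(W)`. [folklore] -/
theorem comap_toGeom_ne_top (P : W.geomPoints) :
    (W.place P).toValuationSubring.comap (toGeom W : W.toAffine.FunctionField →+* W.geomFunctionField) ≠ ⊤ := by
  obtain ⟨z, hz⟩ := exists_toGeom_not_mem_place W P
  intro h
  apply hz
  have hz' : z ∈ (W.place P).toValuationSubring.comap
      (toGeom W : W.toAffine.FunctionField →+* W.geomFunctionField) := by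
    rw [h]; exact ValuationSubring.mem_top z
  exact hz'

/-- Constants of `k` lie in `ι⁻¹(k̄[W]_P)`. [folklore] -/
theorem algebraMap_mem_comap_toGeom (P : W.geomPoints) (c : F) :
    algebraMap F W.toAffine.FunctionField c ∈ (W.place P).toValuationSubring.comap
      (toGeom W : W.toAffine.FunctionField →+* W.geomFunctionField) := by
  change toGeom W (algebraMap F _ c) ∈ (W.place P).toValuationSubring
  rw [AlgHom.commutes, IsScalarTower.algebraMap_apply F (AlgebraicClosure F) W.geomFunctionField]
  exact (W.place P).algebraMap_mem _

/-- **The place of `k(W)` below the geometric point `P`**: the valuation ring `ι⁻¹(k̄[W]_P)` (the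
restriction of the place of `k̄(W)` at `P` to `k(W)` along `ι`). Geometrically: the closed point of
the curve over `k` containing `P`. [cite: SilvermanAEC2009, II.§1–§2] [cite: Stichtenoth2009, Thm. 3.6.3] -/
def belowPlace (P : W.geomPoints) : PlaceOver F W.toAffine.FunctionField where
  toValuationSubring :=
    (W.place P).toValuationSubring.comap (toGeom W : W.toAffine.FunctionField →+* W.geomFunctionField)
  ne_top := comap_toGeom_ne_top W P
  isDVR := IsAlgFunctionField.isDiscreteValuationRing_of_ne_top_of_algebraMap_mem (K := F) _
    (comap_toGeom_ne_top W P) (algebraMap_mem_comap_toGeom W P)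
  algebraMap_mem := algebraMap_mem_comap_toGeom W P

/-- Membership in the place below `P` (definitional): `z ∈ ι⁻¹(k̄[W]_P) ↔ ι z ∈ k̄[W]_P`. [folklore] -/
theorem mem_belowPlace_iff (P : W.geomPoints) (z : W.toAffine.FunctionField) :
    z ∈ (belowPlace W P).toValuationSubring ↔ toGeom W z ∈ (W.place P).toValuationSubring :=
  Iff.rfl

omit [W.IsElliptic] in
/-- In a valuation ring: `v(x) < 1 ↔ x = 0 ∨ x⁻¹ ∉ O`. [folklore] -/
theorem valuation_lt_one_iff_eq_zero_or {L : Type*} [Field L] (O : ValuationSubring L) (x : L) :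
    O.valuation x < 1 ↔ x = 0 ∨ x⁻¹ ∉ O := by
  by_cases hx : x = 0
  · simp [hx]
  simp only [hx, false_or]
  rw [← O.valuation_le_one_iff, not_le, Valuation.one_lt_val_iff _ (inv_ne_zero hx), inv_inv]

/-- `v(z) < 1` at the place below `P` iff `v_P(ι z) < 1`. [folklore] -/
theorem valuation_belowPlace_lt_one_iff (P : W.geomPoints) (z : W.toAffine.FunctionField) :
    (belowPlace W P).valuation z < 1 ↔
      placeValuation (W.baseChange (AlgebraicClosure F)).toAffine P (toGeom W z) < 1 := by
  rw [PlaceOver.valuation, valuation_lt_one_iff_eq_zero_or, ← mem_nonunits_place_iff,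
    ValuationSubring.mem_nonunits_iff, valuation_lt_one_iff_eq_zero_or, mem_belowPlace_iff, map_inv₀,
    map_eq_zero_iff _ (toGeom_injective W)]

/-- **The place below `O` is the place at infinity of `k(W)`.** [cite: SilvermanAEC2009, II.§2] -/
theorem belowPlace_zero : belowPlace W 0 = WeierstrassPlaceAtInfinity.infPlace W.toAffine := by
  refine WeierstrassPlaces.eq_infPlace W.toAffine ?_
  rw [mem_belowPlace_iff, show algebraMap F[X] W.toAffine.FunctionField X = xF W.toAffine from rfl,
    toGeom_xF, place_zero]
  exact WeierstrassPlaceAtInfinity.x_not_mem_infPlace _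

/-- **`Γ_k`-conjugate points lie over the same place**: `belowPlace (σ P) = belowPlace P`.
[cite: SilvermanAEC2009, II.§2] [cite: Stichtenoth2009, Thm. 3.6.3] -/
theorem belowPlace_smul (σ : Field.absoluteGaloisGroup F) (P : W.geomPoints) :
    belowPlace W (σ • P) = belowPlace W P := by
  apply PlaceOver.ext
  ext z
  exact toGeom_mem_place_smul_iff W σ P z

/-- **Regular functions are regular at every affine geometric point**: `k[W] ⊆ ι⁻¹(k̄[W]_P)`.
[cite: SilvermanAEC2009, II.§1] -/
theorem algebraMap_mem_belowPlace {a b : AlgebraicClosure F}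
    (h : (W.baseChange (AlgebraicClosure F)).toAffine.Nonsingular a b) (r : W.toAffine.CoordinateRing) :
    algebraMap W.toAffine.CoordinateRing W.toAffine.FunctionField r ∈
      (belowPlace W (.some a b h)).toValuationSubring :=
  ((hasValueAt_toGeom_algebraMap W h r).mem_place (Affine.Point.some_ne_zero _)).1

/-- In particular `x ∈ ι⁻¹(k̄[W]_P)` for affine `P`: the place below an affine point is finite.
[cite: SilvermanAEC2009, II.§1] -/
theorem xF_mem_belowPlace {P : W.geomPoints} (hP : P ≠ 0) :
    xF W.toAffine ∈ (belowPlace W P).toValuationSubring := by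
  obtain ⟨a, b, h, rfl⟩ := geomPoints.exists_eq_some hP
  exact algebraMap_mem_belowPlace W h (algebraMap F[X] W.toAffine.CoordinateRing X)

/-- The place below an affine point is not the place at infinity. [folklore] -/
theorem belowPlace_ne_infPlace {P : W.geomPoints} (hP : P ≠ 0) :
    belowPlace W P ≠ WeierstrassPlaceAtInfinity.infPlace W.toAffine := fun h =>
  WeierstrassPlaceAtInfinity.x_not_mem_infPlace W.toAffine (h ▸ xF_mem_belowPlace W hP)

/-- **A regular function lies in the maximal ideal of the place below `P = (a, b)` iff it vanishes
at `P`.** [cite: SilvermanAEC2009, II.§1] -/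
theorem valuation_algebraMap_lt_one_iff {a b : AlgebraicClosure F}
    (h : (W.baseChange (AlgebraicClosure F)).toAffine.Nonsingular a b) (r : W.toAffine.CoordinateRing) :
    (belowPlace W (.some a b h)).valuation (algebraMap W.toAffine.CoordinateRing W.toAffine.FunctionField r) < 1 ↔
      evalBase W h r = 0 := by
  have hP : (Affine.Point.some a b h : W.geomPoints) ≠ 0 := Affine.Point.some_ne_zero _
  have hv := hasValueAt_toGeom_algebraMap W h r
  rw [valuation_belowPlace_lt_one_iff, ← mem_nonunits_place_iff]
  constructor
  · intro hmem
    by_contra hc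
    have hinv := (hv.inv hP hc).mem_place hP
    exact inv_not_mem_of_mem_nonunits _ (hv.ne_zero hP hc) hmem hinv.1
  · intro hc
    have := (hv.mem_place hP).2
    rwa [hc, map_zero, sub_zero] at this

end BelowPlace

/-! ### The prime of `k[W]` cut out by a geometric point; the place below is its finite place -/

section KerPrime

variable [W.IsElliptic]

omit [W.IsElliptic] in
/-- Some nonzero regular function vanishes at the affine geometric point `(a, b)`: `μ(x)` for the
minimal polynomial `μ` of `a` over `k`. [folklore] -/
theorem exists_ne_zero_evalBase_eq_zero {a b : AlgebraicClosure F}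
    (h : (W.baseChange (AlgebraicClosure F)).toAffine.Nonsingular a b) :
    ∃ r : W.toAffine.CoordinateRing, r ≠ 0 ∧ evalBase W h r = 0 := by
  set μ : F[X] := minpoly F a with hμ
  have hμ0 : μ ≠ 0 := minpoly.ne_zero (Algebra.IsIntegral.isIntegral a)
  refine ⟨algebraMap F[X] W.toAffine.CoordinateRing μ, fun h0 => hμ0
    (Literature.NumberTheory.EllipticCurves.WeierstrassCoordinateRing.algebraMap_injective W.toAffine
      (by rw [h0, map_zero])), ?_⟩
  rw [evalBase, pointAlgHom_algebraMap, hμ, minpoly.aeval]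

/-- **The prime `𝔭_P = {r ∈ k[W] : r(P) = 0}` of the affine geometric point `P = (a, b)`** (the
closed point of the affine curve over `k` containing `P`), as a nonzero prime of the Dedekind domain
`k[W]`. [cite: SilvermanAEC2009, II.§1–§2] -/
def kerPrime {a b : AlgebraicClosure F} (h : (W.baseChange (AlgebraicClosure F)).toAffine.Nonsingular a b) :
    IsDedekindDomain.HeightOneSpectrum W.toAffine.CoordinateRing where
  asIdeal := RingHom.ker (evalBase W h).toRingHom
  isPrime := RingHom.ker_isPrime _
  ne_bot h0 := by
    obtain ⟨r, hr0, hr⟩ := exists_ne_zero_evalBase_eq_zero W h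
    have : r ∈ RingHom.ker (evalBase W h).toRingHom := hr
    rw [h0, Ideal.mem_bot] at this
    exact hr0 this

omit [W.IsElliptic] in
/-- Membership in `𝔭_P`: `r ∈ 𝔭_P ↔ r(P) = 0`. [folklore] -/
theorem mem_kerPrime_iff {a b : AlgebraicClosure F} (h : (W.baseChange (AlgebraicClosure F)).toAffine.Nonsingular a b)
    (r : W.toAffine.CoordinateRing) : r ∈ (kerPrime W h).asIdeal ↔ evalBase W h r = 0 :=
  Iff.rfl

/-- **The place below an affine geometric point `P` is the finite place of `𝔭_P`**: `ι⁻¹(k̄[W]_P)`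
contains `k[W]_{𝔭_P}` (a fraction `n/d` with `d(P) ≠ 0` is regular at `P`), and a discrete
valuation ring is a maximal proper subring. [cite: SilvermanAEC2009, II.§1–§2] -/
theorem belowPlace_some_eq_ofPrime {a b : AlgebraicClosure F}
    (h : (W.baseChange (AlgebraicClosure F)).toAffine.Nonsingular a b) :
    belowPlace W (.some a b h) = PlaceOver.ofPrime F W.toAffine.FunctionField (kerPrime W h) := by
  symm
  refine PlaceOver.eq_of_le fun z hz => ?_
  rw [PlaceOver.mem_ofPrime_iff] at hz
  obtain ⟨n, d, hnd⟩ := (kerPrime W h).exists_primeCompl_mul_eq_of_integer z hz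
  have hd : evalBase W h (d : W.toAffine.CoordinateRing) ≠ 0 := fun h0 => d.2 h0
  have hP : (Affine.Point.some a b h : W.geomPoints) ≠ 0 := Affine.Point.some_ne_zero _
  have hvn := hasValueAt_toGeom_algebraMap W h n
  have hvd := hasValueAt_toGeom_algebraMap W h (d : W.toAffine.CoordinateRing)
  have hd0 : toGeom W (algebraMap W.toAffine.CoordinateRing W.toAffine.FunctionField
      (d : W.toAffine.CoordinateRing)) ≠ 0 :=
    hvd.ne_zero hP hd
  have hz' : toGeom W z = toGeom W (algebraMap _ W.toAffine.FunctionField n) /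
      toGeom W (algebraMap _ W.toAffine.FunctionField (d : W.toAffine.CoordinateRing)) := by
    rw [eq_div_iff hd0, ← map_mul, hnd]
  rw [mem_belowPlace_iff, hz']
  exact ((hvn.div hP hvd hd).mem_place hP).1

/-- **Every place of `k(W)` is the place at infinity or the finite place of some prime `𝔭`** (the
tree's classification, restated). [cite: SilvermanAEC2009, Prop. II.1.1] -/
theorem eq_infPlace_or_exists_eq_ofPrime (v : PlaceOver F W.toAffine.FunctionField) :
    v = WeierstrassPlaceAtInfinity.infPlace W.toAffine ∨
      ∃ 𝔭 : IsDedekindDomain.HeightOneSpectrum W.toAffine.CoordinateRing,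
        v = PlaceOver.ofPrime F W.toAffine.FunctionField 𝔭 :=
  WeierstrassPlaces.eq_infPlace_or_exists_eq_ofPrime W.toAffine v

end KerPrime

/-! ### The residue field of a finite place of `k(W)` is `k[W]/𝔭` -/

section ResidueQuot

variable [W.IsElliptic]

/-- `k[W] ⊆ 𝒪_𝔭` for the finite place of `𝔭`. [folklore] -/
theorem algebraMap_mem_ofPrime (𝔭 : IsDedekindDomain.HeightOneSpectrum W.toAffine.CoordinateRing)
    (r : W.toAffine.CoordinateRing) :
    algebraMap W.toAffine.CoordinateRing W.toAffine.FunctionField r ∈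
      (PlaceOver.ofPrime F W.toAffine.FunctionField 𝔭).toValuationSubring := by
  rw [PlaceOver.mem_ofPrime_iff]
  exact 𝔭.valuation_le_one r

/-- The map `k[W] → 𝒪_𝔭`. [folklore] -/
def toIntOfPrime (𝔭 : IsDedekindDomain.HeightOneSpectrum W.toAffine.CoordinateRing) :
    W.toAffine.CoordinateRing →+* (PlaceOver.ofPrime F W.toAffine.FunctionField 𝔭).toValuationSubring :=
  (algebraMap W.toAffine.CoordinateRing W.toAffine.FunctionField).codRestrict _ (algebraMap_mem_ofPrime W 𝔭)

/-- Underlying map of `toIntOfPrime` (definitional). [folklore] -/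
@[simp] theorem coe_toIntOfPrime (𝔭 : IsDedekindDomain.HeightOneSpectrum W.toAffine.CoordinateRing)
    (r : W.toAffine.CoordinateRing) :
    ((toIntOfPrime W 𝔭 r : (PlaceOver.ofPrime F W.toAffine.FunctionField 𝔭).toValuationSubring) :
      W.toAffine.FunctionField) = algebraMap W.toAffine.CoordinateRing W.toAffine.FunctionField r :=
  rfl

/-- `v_𝔭(z) < 1` at the place of `𝔭` iff the `𝔭`-adic valuation is `< 1`. [folklore] -/
theorem valuation_ofPrime_lt_one_iff (𝔭 : IsDedekindDomain.HeightOneSpectrum W.toAffine.CoordinateRing)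
    (z : W.toAffine.FunctionField) :
    (PlaceOver.ofPrime F W.toAffine.FunctionField 𝔭).valuation z < 1 ↔
      𝔭.valuation W.toAffine.FunctionField z < 1 :=
  (Valuation.isEquiv_valuation_valuationSubring (𝔭.valuation W.toAffine.FunctionField)).lt_one_iff_lt_one.symm

/-- **`r ∈ 𝔭 ↔ r ≡ 0` at the place of `𝔭`** for `r ∈ k[W]`. [folklore] -/
theorem toIntOfPrime_mem_maximalIdeal_iff (𝔭 : IsDedekindDomain.HeightOneSpectrum W.toAffine.CoordinateRing)
    (r : W.toAffine.CoordinateRing) :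
    toIntOfPrime W 𝔭 r ∈ IsLocalRing.maximalIdeal _ ↔ r ∈ 𝔭.asIdeal := by
  rw [ValuationSubring.valuation_lt_one_iff, coe_toIntOfPrime]
  exact (valuation_ofPrime_lt_one_iff W 𝔭 _).trans (IsDedekindDomain.HeightOneSpectrum.valuation_lt_one_iff_mem 𝔭 r)

/-- **The residue map `k[W] → κ(𝔭)`** into the residue field of the finite place of `𝔭`, a
`k`-algebra map. [cite: SilvermanAEC2009, II.§1] [cite: Stichtenoth2009, Def. 1.1.13] -/
def resOfPrime (𝔭 : IsDedekindDomain.HeightOneSpectrum W.toAffine.CoordinateRing) :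
    W.toAffine.CoordinateRing →ₐ[F] (PlaceOver.ofPrime F W.toAffine.FunctionField 𝔭).residueField :=
  { (IsLocalRing.residue _).comp (toIntOfPrime W 𝔭) with
    commutes' := fun c => by
      change IsLocalRing.residue _ (toIntOfPrime W 𝔭 (algebraMap F _ c)) = algebraMap F _ c
      rw [PlaceOver.algebraMap_residueField_apply]
      congr 1 }

/-- Unfolding `resOfPrime`. [folklore] -/
theorem resOfPrime_apply (𝔭 : IsDedekindDomain.HeightOneSpectrum W.toAffine.CoordinateRing)
    (r : W.toAffine.CoordinateRing) :
    resOfPrime W 𝔭 r = IsLocalRing.residue _ (toIntOfPrime W 𝔭 r) := rfl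

/-- `resOfPrime r = 0 ↔ r ∈ 𝔭`. [folklore] -/
theorem resOfPrime_eq_zero_iff (𝔭 : IsDedekindDomain.HeightOneSpectrum W.toAffine.CoordinateRing)
    (r : W.toAffine.CoordinateRing) : resOfPrime W 𝔭 r = 0 ↔ r ∈ 𝔭.asIdeal := by
  rw [resOfPrime_apply, IsLocalRing.residue_eq_zero_iff, toIntOfPrime_mem_maximalIdeal_iff]

/-- **`k[W]/𝔭 → κ(𝔭)`.** [cite: Stichtenoth2009, Def. 1.1.13] -/
def quotToResidueField (𝔭 : IsDedekindDomain.HeightOneSpectrum W.toAffine.CoordinateRing) :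
    (W.toAffine.CoordinateRing ⧸ 𝔭.asIdeal) →ₐ[F]
      (PlaceOver.ofPrime F W.toAffine.FunctionField 𝔭).residueField :=
  Ideal.Quotient.liftₐ 𝔭.asIdeal (resOfPrime W 𝔭) fun a ha => (resOfPrime_eq_zero_iff W 𝔭 a).2 ha

/-- `quotToResidueField` on classes (definitional). [folklore] -/
theorem quotToResidueField_mk (𝔭 : IsDedekindDomain.HeightOneSpectrum W.toAffine.CoordinateRing)
    (r : W.toAffine.CoordinateRing) :
    quotToResidueField W 𝔭 (Ideal.Quotient.mk _ r) = resOfPrime W 𝔭 r := rfl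

/-- **`k[W]/𝔭 → κ(𝔭)` is bijective** (injective: a field homomorphism; surjective: an element
`n/d` of `𝒪_𝔭 = k[W]_𝔭`, `d ∉ 𝔭`, has residue `n̄ d̄⁻¹`). [cite: Stichtenoth2009, Def. 1.1.13 and Prop. 1.1.15] -/
theorem quotToResidueField_bijective (𝔭 : IsDedekindDomain.HeightOneSpectrum W.toAffine.CoordinateRing) :
    Function.Bijective (quotToResidueField W 𝔭) := by
  haveI : 𝔭.asIdeal.IsMaximal := 𝔭.isMaximal
  letI : Field (W.toAffine.CoordinateRing ⧸ 𝔭.asIdeal) := Ideal.Quotient.field _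
  refine ⟨(quotToResidueField W 𝔭).toRingHom.injective, fun t => ?_⟩
  obtain ⟨⟨z, hz⟩, rfl⟩ := IsLocalRing.residue_surjective t
  have hz' : 𝔭.valuation W.toAffine.FunctionField z ≤ 1 := (PlaceOver.mem_ofPrime_iff _ _).1 hz
  obtain ⟨n, d, hnd⟩ := 𝔭.exists_primeCompl_mul_eq_of_integer z hz'
  have hd : resOfPrime W 𝔭 (d : W.toAffine.CoordinateRing) ≠ 0 := fun h0 =>
    d.2 ((resOfPrime_eq_zero_iff W 𝔭 _).1 h0)
  refine ⟨Ideal.Quotient.mk _ n * (Ideal.Quotient.mk _ (d : W.toAffine.CoordinateRing))⁻¹, ?_⟩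
  rw [map_mul, map_inv₀, quotToResidueField_mk, quotToResidueField_mk, eq_comm,
    eq_mul_inv_iff_mul_eq₀ hd, resOfPrime_apply, resOfPrime_apply, ← map_mul]
  congr 1
  exact Subtype.ext hnd

/-- **`κ(𝔭) ≅ k[W]/𝔭`** as `k`-algebras, for the finite place of `𝔭`. [cite: Stichtenoth2009, Def. 1.1.13] -/
def quotEquivResidueField (𝔭 : IsDedekindDomain.HeightOneSpectrum W.toAffine.CoordinateRing) :
    (W.toAffine.CoordinateRing ⧸ 𝔭.asIdeal) ≃ₐ[F]
      (PlaceOver.ofPrime F W.toAffine.FunctionField 𝔭).residueField :=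
  AlgEquiv.ofBijective (quotToResidueField W 𝔭) (quotToResidueField_bijective W 𝔭)

/-- `k[W]/𝔭` is finite-dimensional over `k` (the residue field of a place of a function field is,
Stichtenoth Prop. 1.1.15). [cite: Stichtenoth2009, Prop. 1.1.15] -/
instance finiteDimensional_quot (𝔭 : IsDedekindDomain.HeightOneSpectrum W.toAffine.CoordinateRing) :
    FiniteDimensional F (W.toAffine.CoordinateRing ⧸ 𝔭.asIdeal) := by
  haveI : FiniteDimensional F (PlaceOver.ofPrime F W.toAffine.FunctionField 𝔭).residueField :=
    PlaceOver.finiteDimensional_residueField_holds _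
  exact LinearEquiv.finiteDimensional (quotEquivResidueField W 𝔭).symm.toLinearEquiv

/-- **`dim_k (k[W]/𝔭) = deg 𝔭`**, the degree of the finite place of `𝔭`. [cite: Stichtenoth2009, Def. 1.1.14] -/
theorem finrank_quot_eq_degree (𝔭 : IsDedekindDomain.HeightOneSpectrum W.toAffine.CoordinateRing) :
    Module.finrank F (W.toAffine.CoordinateRing ⧸ 𝔭.asIdeal) =
      (PlaceOver.ofPrime F W.toAffine.FunctionField 𝔭).degree :=
  (quotEquivResidueField W 𝔭).toLinearEquiv.finrank_eq

end ResidueQuot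

/-! ### `Γ_k` on the evaluations; the residue embedding `k[W]/𝔭_P → k̄` -/

section ResEmb

variable [W.IsElliptic]

omit [W.IsElliptic] in
/-- Two `k`-algebra maps out of `k[W]` agreeing on `x` and `y` are equal. [folklore] -/
theorem algHom_coordinateRing_ext {A : Type*} [Semiring A] [Algebra F A]
    {f g : W.toAffine.CoordinateRing →ₐ[F] A}
    (hx : f (Affine.CoordinateRing.mk W.toAffine (C X)) = g (Affine.CoordinateRing.mk W.toAffine (C X)))
    (hy : f (Affine.CoordinateRing.mk W.toAffine X) = g (Affine.CoordinateRing.mk W.toAffine X)) :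
    f = g := by
  refine Ideal.Quotient.algHom_ext F (Polynomial.algHom_ext' (Polynomial.algHom_ext ?_) ?_)
  · exact hx
  · exact hy

omit [W.IsElliptic] in
/-- The coordinates of `τ • P` are `τ` of the coordinates. [folklore] -/
theorem smul_some_eq (τ : Field.absoluteGaloisGroup F) {a b : AlgebraicClosure F}
    (h : (W.baseChange (AlgebraicClosure F)).toAffine.Nonsingular a b) :
    ∃ h' : (W.baseChange (AlgebraicClosure F)).toAffine.Nonsingular (τ • a) (τ • b),
      τ • (show W.geomPoints from Affine.Point.some a b h) =
        (show W.geomPoints from Affine.Point.some (τ • a) (τ • b) h') :=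
  ⟨_, rfl⟩

omit [W.IsElliptic] in
/-- `τ ∈ Γ_k` fixes the polynomials with coefficients in `k`. [folklore] -/
theorem map_mapRingHom_galRingHom (τ : Field.absoluteGaloisGroup F) (p : F[X][Y]) :
    (p.map (mapRingHom (algebraMap F (AlgebraicClosure F)))).map (mapRingHom (galRingHom τ)) =
      p.map (mapRingHom (algebraMap F (AlgebraicClosure F))) := by
  rw [Polynomial.map_map, mapRingHom_comp]
  congr 2
  ext c
  exact (galAlgEquiv τ).commutes c

omit [W.IsElliptic] in
/-- **`r(τ P) = τ (r(P))`** for `r ∈ k[W]` and `τ ∈ Γ_k` (`r` has coefficients in `k`).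
[cite: SilvermanAEC2009, II.§2] -/
theorem evalBase_smul (τ : Field.absoluteGaloisGroup F) {a b : AlgebraicClosure F}
    (h : (W.baseChange (AlgebraicClosure F)).toAffine.Nonsingular a b)
    (h' : (W.baseChange (AlgebraicClosure F)).toAffine.Nonsingular (τ • a) (τ • b)) (r : W.toAffine.CoordinateRing) :
    evalBase W h' r = τ • evalBase W h r := by
  obtain ⟨p, rfl⟩ := AdjoinRoot.mk_surjective r
  change evalBase W h' (Affine.CoordinateRing.mk W.toAffine p) = τ • evalBase W h (Affine.CoordinateRing.mk W.toAffine p)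
  rw [evalBase_mk, evalBase_mk]
  simp only [← galRingHom_apply]
  rw [← Polynomial.map_mapRingHom_evalEval (galRingHom τ), map_mapRingHom_galRingHom]

/-- **The residue embedding `k[W]/𝔭_P → k̄`** of the affine geometric point `P = (a, b)`: `r̄ ↦ r(P)`
(an injective `k`-algebra map; its image is the residue field `k(P)` of the closed point of `P`).
[cite: SilvermanAEC2009, II.§1–§2] [cite: Stichtenoth2009, Thm. 3.6.3] -/
def resEmb {a b : AlgebraicClosure F} (h : (W.baseChange (AlgebraicClosure F)).toAffine.Nonsingular a b) :
    (W.toAffine.CoordinateRing ⧸ (kerPrime W h).asIdeal) →ₐ[F] AlgebraicClosure F :=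
  Ideal.Quotient.liftₐ _ (evalBase W h) fun _ ha => ha

omit [W.IsElliptic] in
/-- `resEmb` on classes (definitional). [folklore] -/
theorem resEmb_mk {a b : AlgebraicClosure F} (h : (W.baseChange (AlgebraicClosure F)).toAffine.Nonsingular a b)
    (r : W.toAffine.CoordinateRing) : resEmb W h (Ideal.Quotient.mk _ r) = evalBase W h r := rfl

/-- `resEmb` is injective. [folklore] -/
theorem resEmb_injective {a b : AlgebraicClosure F} (h : (W.baseChange (AlgebraicClosure F)).toAffine.Nonsingular a b) :
    Function.Injective (resEmb W h) := by
  haveI : (kerPrime W h).asIdeal.IsMaximal := (kerPrime W h).isMaximal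
  letI : Field (W.toAffine.CoordinateRing ⧸ (kerPrime W h).asIdeal) := Ideal.Quotient.field _
  exact (resEmb W h).toRingHom.injective

omit [W.IsElliptic] in
/-- `resEmb` of the class of `x` is `a`. [folklore] -/
theorem resEmb_mk_X {a b : AlgebraicClosure F} (h : (W.baseChange (AlgebraicClosure F)).toAffine.Nonsingular a b) :
    resEmb W h (Ideal.Quotient.mk _ (Affine.CoordinateRing.mk W.toAffine (C X))) = a := by
  rw [resEmb_mk, evalBase_mk]; simp [Polynomial.evalEval_C]

omit [W.IsElliptic] in
/-- `resEmb` of the class of `y` is `b`. [folklore] -/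
theorem resEmb_mk_Y {a b : AlgebraicClosure F} (h : (W.baseChange (AlgebraicClosure F)).toAffine.Nonsingular a b) :
    resEmb W h (Ideal.Quotient.mk _ (Affine.CoordinateRing.mk W.toAffine X)) = b := by
  rw [resEmb_mk, evalBase_mk]; simp [Polynomial.evalEval_X]

omit [W.IsElliptic] in
/-- Two `k`-algebra maps out of `k[W]/𝔭` agreeing on the classes of `x` and `y` are equal. [folklore] -/
theorem algHom_quot_ext {a b : AlgebraicClosure F} (h : (W.baseChange (AlgebraicClosure F)).toAffine.Nonsingular a b)
    {A : Type*} [Semiring A] [Algebra F A]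
    {f g : (W.toAffine.CoordinateRing ⧸ (kerPrime W h).asIdeal) →ₐ[F] A}
    (hx : f (Ideal.Quotient.mk _ (Affine.CoordinateRing.mk W.toAffine (C X))) =
      g (Ideal.Quotient.mk _ (Affine.CoordinateRing.mk W.toAffine (C X))))
    (hy : f (Ideal.Quotient.mk _ (Affine.CoordinateRing.mk W.toAffine X)) =
      g (Ideal.Quotient.mk _ (Affine.CoordinateRing.mk W.toAffine X))) : f = g := by
  refine Ideal.Quotient.algHom_ext F ?_
  exact algHom_coordinateRing_ext W hx hy

end ResEmb

/-! ### Over a finite field: the fibres of `belowPlace` are Frobenius orbits of size `deg v` -/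

section Fibres

variable [W.IsElliptic] [Finite F]
variable (σ : Field.absoluteGaloisGroup F) (hσ : ∀ x : AlgebraicClosure F, σ • x = x ^ Nat.card F)

omit [W.IsElliptic] [Finite F] in
include hσ in
/-- `σ^j` acts on `k̄` as `x ↦ x^{q^j}`. [folklore] -/
theorem pow_smul_eq_pow_pow (j : ℕ) (x : AlgebraicClosure F) : (σ ^ j) • x = x ^ (Nat.card F ^ j) := by
  induction j with
  | zero => simp
  | succ j ih => rw [pow_succ', mul_smul, ih, hσ, ← pow_mul, ← pow_succ]

omit [W.IsElliptic] [Finite F] in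
include hσ in
/-- **`σ^j (r(P)) = (r^{q^j})(P)`**: on the residue embedding, `σ^j ∘ resEmb = resEmb ∘ Frob^j`.
[cite: SilvermanAEC2009, II.§2] -/
theorem pow_smul_resEmb {a b : AlgebraicClosure F} (h : (W.baseChange (AlgebraicClosure F)).toAffine.Nonsingular a b)
    (j : ℕ) (c : W.toAffine.CoordinateRing ⧸ (kerPrime W h).asIdeal) :
    (σ ^ j) • resEmb W h c = resEmb W h (c ^ (Nat.card F ^ j)) := by
  rw [pow_smul_eq_pow_pow σ hσ, map_pow]

/-- The residue ring `k[W]/𝔭_P` is finite. [folklore] -/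
instance finite_quot {a b : AlgebraicClosure F} (h : (W.baseChange (AlgebraicClosure F)).toAffine.Nonsingular a b) :
    Finite (W.toAffine.CoordinateRing ⧸ (kerPrime W h).asIdeal) :=
  Module.finite_of_finite F

/-- The order of the Frobenius of `k[W]/𝔭_P` is the degree of the place below `P`. [folklore] -/
theorem orderOf_frobeniusAlgHom_quot [Fintype F] {a b : AlgebraicClosure F}
    (h : (W.baseChange (AlgebraicClosure F)).toAffine.Nonsingular a b) :
    orderOf (FiniteField.frobeniusAlgHom F (W.toAffine.CoordinateRing ⧸ (kerPrime W h).asIdeal)) =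
      (belowPlace W (.some a b h)).degree := by
  haveI : (kerPrime W h).asIdeal.IsMaximal := (kerPrime W h).isMaximal
  letI : Field (W.toAffine.CoordinateRing ⧸ (kerPrime W h).asIdeal) := Ideal.Quotient.field _
  rw [FiniteField.orderOf_frobeniusAlgHom, finrank_quot_eq_degree, belowPlace_some_eq_ofPrime]

include hσ in
/-- **`σ^{deg v} P = P`** for an affine geometric point `P` above the place `v`: the coordinates of
`P` lie in the field `k(P) ≅ k[W]/𝔭_P` of degree `deg v` over `k`. [cite: Stichtenoth2009, Thm. 3.6.3] -/
theorem pow_degree_smul_eq {a b : AlgebraicClosure F} (h : (W.baseChange (AlgebraicClosure F)).toAffine.Nonsingular a b) :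
    (σ ^ (belowPlace W (.some a b h)).degree) • (show W.geomPoints from .some a b h) =
      (show W.geomPoints from .some a b h) := by
  haveI := Fintype.ofFinite F
  haveI : (kerPrime W h).asIdeal.IsMaximal := (kerPrime W h).isMaximal
  letI : Field (W.toAffine.CoordinateRing ⧸ (kerPrime W h).asIdeal) := Ideal.Quotient.field _
  set d := (belowPlace W (.some a b h)).degree with hd
  obtain ⟨h', e⟩ := smul_some_eq W (σ ^ d) h
  rw [e]
  have key : ∀ c : W.toAffine.CoordinateRing ⧸ (kerPrime W h).asIdeal,
      (σ ^ d) • resEmb W h c = resEmb W h c := by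
    intro c
    rw [pow_smul_resEmb W σ hσ h d c]
    congr 1
    have hfrob := pow_orderOf_eq_one (FiniteField.frobeniusAlgHom F (W.toAffine.CoordinateRing ⧸ (kerPrime W h).asIdeal))
    rw [orderOf_frobeniusAlgHom_quot W h, ← hd] at hfrob
    have := DFunLike.congr_fun hfrob c
    rwa [AlgHom.coe_pow, FiniteField.coe_frobeniusAlgHom, pow_iterate, AlgHom.one_apply,
      Fintype.card_eq_nat_card] at this
  have ha : (σ ^ d) • a = a := by
    have := key (Ideal.Quotient.mk _ (Affine.CoordinateRing.mk W.toAffine (C X)))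
    rwa [resEmb_mk_X] at this
  have hb : (σ ^ d) • b = b := by
    have := key (Ideal.Quotient.mk _ (Affine.CoordinateRing.mk W.toAffine X))
    rwa [resEmb_mk_Y] at this
  simp only [ha, hb]

include hσ in
/-- **The points `σ^j P`, `j < deg v`, are pairwise distinct** (`P` affine above `v`): if
`σ^i P = σ^j P` then `Frob^i = Frob^j` on `k[W]/𝔭_P` (compare on the classes of `x`, `y`), and the
Frobenius has order `deg v`. [cite: Stichtenoth2009, Thm. 3.6.3] -/
theorem pow_smul_injOn {a b : AlgebraicClosure F} (h : (W.baseChange (AlgebraicClosure F)).toAffine.Nonsingular a b) :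
    Set.InjOn (fun j : ℕ => (σ ^ j) • (show W.geomPoints from .some a b h))
      (Set.Iio (belowPlace W (.some a b h)).degree) := by
  haveI := Fintype.ofFinite F
  haveI : (kerPrime W h).asIdeal.IsMaximal := (kerPrime W h).isMaximal
  letI : Field (W.toAffine.CoordinateRing ⧸ (kerPrime W h).asIdeal) := Ideal.Quotient.field _
  intro i hi j hj hij
  simp only at hij
  obtain ⟨hi', ei⟩ := smul_some_eq W (σ ^ i) h
  obtain ⟨hj', ej⟩ := smul_some_eq W (σ ^ j) h
  rw [ei, ej] at hij
  obtain ⟨ha, hb⟩ := Affine.Point.some.inj hij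
  -- `Frob^i = Frob^j` on the residue ring
  set φ := FiniteField.frobeniusAlgHom F (W.toAffine.CoordinateRing ⧸ (kerPrime W h).asIdeal) with hφ
  have hpow : ∀ (k : ℕ) (c : W.toAffine.CoordinateRing ⧸ (kerPrime W h).asIdeal),
      (φ ^ k) c = c ^ (Nat.card F ^ k) := fun k c => by
    rw [AlgHom.coe_pow, hφ, FiniteField.coe_frobeniusAlgHom, pow_iterate, Fintype.card_eq_nat_card]
  have hφij : φ ^ i = φ ^ j := by
    refine algHom_quot_ext W h ?_ ?_
    · apply resEmb_injective W h
      rw [hpow, hpow, ← pow_smul_resEmb W σ hσ h, ← pow_smul_resEmb W σ hσ h, resEmb_mk_X, ha]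
    · apply resEmb_injective W h
      rw [hpow, hpow, ← pow_smul_resEmb W σ hσ h, ← pow_smul_resEmb W σ hσ h, resEmb_mk_Y, hb]
  have hord := orderOf_frobeniusAlgHom_quot W h
  rw [← hφ] at hord
  refine pow_injOn_Iio_orderOf ?_ ?_ hφij
  · rw [Set.mem_Iio, hord]; exact hi
  · rw [Set.mem_Iio, hord]; exact hj

include hσ in
/-- **Every geometric point above the place below `P` is a Frobenius translate `σ^j P`, `j < deg v`**
(`P` affine): the evaluation at such a point is one of the `deg v` embeddings `k[W]/𝔭_P → k̄` over
`k`, which are `resEmb ∘ Frob^j`, `j < deg v`. [cite: Stichtenoth2009, Thm. 3.6.3] -/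
theorem exists_eq_pow_smul {a b : AlgebraicClosure F} (h : (W.baseChange (AlgebraicClosure F)).toAffine.Nonsingular a b)
    {R : W.geomPoints} (hR : belowPlace W R = belowPlace W (.some a b h)) :
    ∃ j < (belowPlace W (.some a b h)).degree, R = (σ ^ j) • (show W.geomPoints from .some a b h) := by
  haveI := Fintype.ofFinite F
  haveI : (kerPrime W h).asIdeal.IsMaximal := (kerPrime W h).isMaximal
  letI : Field (W.toAffine.CoordinateRing ⧸ (kerPrime W h).asIdeal) := Ideal.Quotient.field _
  set d := (belowPlace W (.some a b h)).degree with hd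
  -- `R` is affine with the same prime
  have hR0 : R ≠ 0 := by
    rintro rfl
    rw [belowPlace_zero] at hR
    exact belowPlace_ne_infPlace W (Affine.Point.some_ne_zero _) hR.symm
  obtain ⟨a', b', h', rfl⟩ := geomPoints.exists_eq_some hR0
  have hker : (kerPrime W h').asIdeal = (kerPrime W h).asIdeal := by
    have := hR
    rw [belowPlace_some_eq_ofPrime, belowPlace_some_eq_ofPrime] at this
    exact congrArg IsDedekindDomain.HeightOneSpectrum.asIdeal (PlaceOver.ofPrime_injective this)
  -- the evaluation at `R` as an embedding of `κ`
  let ψ : (W.toAffine.CoordinateRing ⧸ (kerPrime W h).asIdeal) →ₐ[F] AlgebraicClosure F :=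
    Ideal.Quotient.liftₐ _ (evalBase W h') fun r hr => by
      change r ∈ (kerPrime W h').asIdeal; rw [hker]; exact hr
  have hψ : ∀ r, ψ (Ideal.Quotient.mk _ r) = evalBase W h' r := fun r => rfl
  -- the `d` embeddings `resEmb ∘ Frob^j`
  set φ := FiniteField.frobeniusAlgHom F (W.toAffine.CoordinateRing ⧸ (kerPrime W h).asIdeal) with hφ
  have hpow : ∀ (k : ℕ) (c : W.toAffine.CoordinateRing ⧸ (kerPrime W h).asIdeal),
      (φ ^ k) c = c ^ (Nat.card F ^ k) := fun k c => by
    rw [AlgHom.coe_pow, hφ, FiniteField.coe_frobeniusAlgHom, pow_iterate, Fintype.card_eq_nat_card]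
  have hord : orderOf φ = d := orderOf_frobeniusAlgHom_quot W h
  let Φ : Fin d → ((W.toAffine.CoordinateRing ⧸ (kerPrime W h).asIdeal) →ₐ[F] AlgebraicClosure F) :=
    fun j => (resEmb W h).comp (φ ^ (j : ℕ))
  have hΦ : Function.Injective Φ := by
    intro i j hij
    apply Fin.ext
    have hφij : φ ^ (i : ℕ) = φ ^ (j : ℕ) := by
      apply AlgHom.ext; intro c
      apply resEmb_injective W h
      exact DFunLike.congr_fun hij c
    refine pow_injOn_Iio_orderOf ?_ ?_ hφij
    · rw [Set.mem_Iio, hord]; exact i.2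
    · rw [Set.mem_Iio, hord]; exact j.2
  have hcard : Fintype.card ((W.toAffine.CoordinateRing ⧸ (kerPrime W h).asIdeal) →ₐ[F] AlgebraicClosure F) = d := by
    have h1 := AlgHom.card F (W.toAffine.CoordinateRing ⧸ (kerPrime W h).asIdeal) (AlgebraicClosure F)
    rw [finrank_quot_eq_degree, ← belowPlace_some_eq_ofPrime, ← hd] at h1
    convert h1
  have hbij : Function.Bijective Φ := by
    rw [Fintype.bijective_iff_injective_and_card]
    exact ⟨hΦ, by rw [Fintype.card_fin, hcard]⟩
  obtain ⟨j, hj⟩ := hbij.2 ψ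
  refine ⟨j, j.2, ?_⟩
  obtain ⟨h'', e⟩ := smul_some_eq W (σ ^ (j : ℕ)) h
  rw [e]
  have ha : a' = (σ ^ (j : ℕ)) • a := by
    have := DFunLike.congr_fun hj (Ideal.Quotient.mk _ (Affine.CoordinateRing.mk W.toAffine (C X)))
    rw [hψ] at this
    change (resEmb W h) ((φ ^ (j : ℕ)) _) = _ at this
    rw [hpow, ← pow_smul_resEmb W σ hσ h, resEmb_mk_X, evalBase_mk] at this
    simpa [Polynomial.evalEval_C] using this.symm
  have hb : b' = (σ ^ (j : ℕ)) • b := by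
    have := DFunLike.congr_fun hj (Ideal.Quotient.mk _ (Affine.CoordinateRing.mk W.toAffine X))
    rw [hψ] at this
    change (resEmb W h) ((φ ^ (j : ℕ)) _) = _ at this
    rw [hpow, ← pow_smul_resEmb W σ hσ h, resEmb_mk_Y, evalBase_mk] at this
    simpa [Polynomial.evalEval_X] using this.symm
  subst ha hb
  rfl

end Fibres

/-! ### Every place of `k(W)` lies below some geometric point -/

section Existence

variable [W.IsElliptic]

omit [W.IsElliptic] in
/-- A `k`-algebra map `χ` out of `k[W]` is evaluation at `(χ x, χ y)`. [folklore] -/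
theorem algHom_mk_eq_evalEval {A : Type*} [CommRing A] [Algebra F A] (χ : W.toAffine.CoordinateRing →ₐ[F] A)
    (p : F[X][Y]) :
    χ (Affine.CoordinateRing.mk W.toAffine p) =
      (p.map (mapRingHom (algebraMap F A))).evalEval (χ (Affine.CoordinateRing.mk W.toAffine (C X)))
        (χ (Affine.CoordinateRing.mk W.toAffine X)) := by
  rw [mk_eq_aevalAeval, map_aevalAeval, aevalAeval_eq_evalEval_map]
  rfl

omit [W.IsElliptic] in
/-- The point `(χ x, χ y)` of a `k`-algebra map `χ : k[W] → A` satisfies the Weierstrass equation. [folklore] -/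
theorem evalEval_algHom_eq_zero {A : Type*} [CommRing A] [Algebra F A] (χ : W.toAffine.CoordinateRing →ₐ[F] A) :
    (W.toAffine.polynomial.map (mapRingHom (algebraMap F A))).evalEval
      (χ (Affine.CoordinateRing.mk W.toAffine (C X))) (χ (Affine.CoordinateRing.mk W.toAffine X)) = 0 := by
  rw [← algHom_mk_eq_evalEval]
  change χ (AdjoinRoot.mk W.toAffine.polynomial W.toAffine.polynomial) = 0
  rw [AdjoinRoot.mk_self, map_zero]

/-- **Every prime `𝔭` of `k[W]` is the prime of some geometric point**: embed the finite extension
`k[W]/𝔭` of `k` into `k̄` and take the images `(a, b)` of `x, y`. [cite: SilvermanAEC2009, II.§1–§2] -/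
theorem exists_kerPrime_eq (𝔭 : IsDedekindDomain.HeightOneSpectrum W.toAffine.CoordinateRing) :
    ∃ (a b : AlgebraicClosure F) (h : (W.baseChange (AlgebraicClosure F)).toAffine.Nonsingular a b),
      kerPrime W h = 𝔭 := by
  haveI : 𝔭.asIdeal.IsMaximal := 𝔭.isMaximal
  letI : Field (W.toAffine.CoordinateRing ⧸ 𝔭.asIdeal) := Ideal.Quotient.field _
  haveI : Algebra.IsAlgebraic F (W.toAffine.CoordinateRing ⧸ 𝔭.asIdeal) := Algebra.IsAlgebraic.of_finite F _
  -- an embedding of the residue field into `k̄`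
  let ε : (W.toAffine.CoordinateRing ⧸ 𝔭.asIdeal) →ₐ[F] AlgebraicClosure F := IsAlgClosed.lift
  let χ : W.toAffine.CoordinateRing →ₐ[F] AlgebraicClosure F := ε.comp (Ideal.Quotient.mkₐ F 𝔭.asIdeal)
  set a := χ (Affine.CoordinateRing.mk W.toAffine (C X)) with ha
  set b := χ (Affine.CoordinateRing.mk W.toAffine X) with hb
  have heq : (W.baseChange (AlgebraicClosure F)).toAffine.Equation a b := by
    rw [Affine.Equation, WeierstrassCurve.baseChange, Affine.map_polynomial]
    exact evalEval_algHom_eq_zero W χ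
  have hns : (W.baseChange (AlgebraicClosure F)).toAffine.Nonsingular a b :=
    (Affine.equation_iff_nonsingular (W := (W.baseChange (AlgebraicClosure F)))).mp heq
  refine ⟨a, b, hns, ?_⟩
  -- the evaluation at `(a, b)` is `χ`
  have hev : evalBase W hns = χ := by
    refine algHom_coordinateRing_ext W ?_ ?_
    · rw [evalBase_mk]; simp [Polynomial.evalEval_C, ha]
    · rw [evalBase_mk]; simp [Polynomial.evalEval_X, hb]
  refine IsDedekindDomain.HeightOneSpectrum.ext (Ideal.ext fun r => ?_)
  rw [mem_kerPrime_iff, hev]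
  change ε (Ideal.Quotient.mk 𝔭.asIdeal r) = 0 ↔ _
  rw [map_eq_zero_iff ε ε.toRingHom.injective, Ideal.Quotient.eq_zero_iff_mem]

/-- **Every place of `k(W)` is the place below some geometric point** (`∞` below `O`, the finite
place of `𝔭` below any point with prime `𝔭`). [cite: SilvermanAEC2009, II.§1–§2] [cite: Stichtenoth2009, Thm. 3.6.3] -/
theorem exists_belowPlace_eq (v : PlaceOver F W.toAffine.FunctionField) : ∃ P : W.geomPoints, belowPlace W P = v := by
  rcases eq_infPlace_or_exists_eq_ofPrime W v with rfl | ⟨𝔭, rfl⟩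
  · exact ⟨0, belowPlace_zero W⟩
  · obtain ⟨a, b, h, h𝔭⟩ := exists_kerPrime_eq W 𝔭
    exact ⟨.some a b h, by rw [belowPlace_some_eq_ofPrime, h𝔭]⟩

/-- The place below a point is the place at infinity iff the point is `O`. [folklore] -/
theorem belowPlace_eq_infPlace_iff (P : W.geomPoints) :
    belowPlace W P = WeierstrassPlaceAtInfinity.infPlace W.toAffine ↔ P = 0 := by
  refine ⟨fun h => ?_, fun h => h ▸ belowPlace_zero W⟩
  by_contra hP
  exact belowPlace_ne_infPlace W hP h

end Existence

end Literature.NumberTheory.EllipticCurves.WeierstrassGeometricPlaces
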